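import Summits.HodgeConjecture.CorCM.CMBalancedWeightSplitting
import HarnessLib

/-!
# The dichotomy «divisor pairs or Weil section» for balanced weights on a CM algebra (total dimension `4`)

Sequel of `CorCM/CMBalancedWeightSplitting` (cell `pub-hodgecm2`, count-neutral sub-row A3-CM45-products; HONEST
FRAMING: combinatorial structure lemmas only — no case of the Hodge conjecture is proved here and `HC_CM` is never
asserted).  Index set `⊔_i Hom(K_i, ℂ)` of a CM algebra `∏_i K_i` (CM fields `K_i`, CM types `Φ_i`, repetitions
allowed), `Aut(ℂ)` acting by composition, `ρ = starRingAut` = complex conjugation, Pohlmann's Galois condition =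
the tree's `IsGaloisBalancedAlg` (`Pohlmann1968/HodgeClassesCMAlgebra`).

* **`section_dichotomy`** — for a balanced FULL SECTION `S` (no conjugate pair inside, every conjugate pair met) and
  `τ ∈ Aut(ℂ)`: either `τ • S = S`, or `τ • S = ρ • S`, or `S = A ⊔ D` with `A`, `D` balanced and nonempty
  (`τ • S` is again a full section, hence `τ • S = (S ∩ τ•S) ⊔ ρ • (S ∖ τ•S)`, and the splitting lemma
  `isGaloisBalancedAlg_split` applies); `weilSection_or_split` — the global form;
* **`mem_pohlmannDivisorSetsAlg_two_or_weilSection`** — on `8` embeddings (`Σ_i [K_i:ℚ] = 8`, total dimension `4`)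
  every balanced `4`-subset is EITHER a disjoint union of two balanced pairs (`pohlmannDivisorSetsAlg Φ 2`: the index
  of a product of two divisor classes) OR a «Weil section»: a full section with `τ • S ∈ {S, ρ • S}` for every
  `τ ∈ Aut(ℂ)` (the index of a generator of the Weil plane of an imaginary quadratic multiplication, see
  `CorCM/CMWeilSectionEndomorphism`).  This is the combinatorial content of the CM slice of Moonen–Zarhin 1999,
  Thm. 0.1 («`B²(X) = D²(X) + Σ W_k`» on abelian fourfolds), with an elementary proof valid for arbitrary CM-algebra
  data (no primitivity, no rank computation, no Mumford–Tate groups).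

## References

* [MoonenZarhin1999LowDim] B. Moonen, Yu. Zarhin, Math. Ann. 315 (1999) 711–733, Thm. 0.1.
* [Gordon1999HodgeAVSurvey] B. B. Gordon, *A survey of the Hodge conjecture for abelian varieties*, §9.2, 9.2.2.
* [GaoUllmo2025] Z. Gao, E. Ullmo, J. Inst. Math. Jussieu 25 (2025), Thm. 3.1 (3.2).
-/

noncomputable section

open NumberField

namespace Summit.HodgeConjecture.CorCM.CMWeights

open Literature.AlgebraicGeometry.Motives (CMType)
open Literature.AlgebraicGeometry.Pohlmann1968
open Literature.NumberTheory.ComplexMultiplication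

open scoped Classical Pointwise

/-! ### §3 The dichotomy for balanced full sections -/

section Dichotomy

variable {n : ℕ} {K : Fin n → Type} [∀ i, Field (K i)] [∀ i, NumberField (K i)] [∀ i, IsCMField (K i)]

/-- A full section stays a full section under `τ ∈ Aut(ℂ)`: if `S` meets every conjugate pair, so does `τ • S`.
[folklore] -/
theorem forall_mem_or_conj_smul_mem_smul_finset {S : Finset ((i : Fin n) × (K i →+* ℂ))}
    (hfull : ∀ x : (i : Fin n) × (K i →+* ℂ), x ∈ S ∨ (starRingAut : ℂ ≃+* ℂ) • x ∈ S)
    (τ : ℂ ≃+* ℂ) (x : (i : Fin n) × (K i →+* ℂ)) :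
    x ∈ τ • S ∨ (starRingAut : ℂ ≃+* ℂ) • x ∈ τ • S := by
  rcases hfull (τ⁻¹ • x) with h | h
  · exact Or.inl (Finset.mem_smul_finset.2 ⟨_, h, smul_inv_smul τ x⟩)
  · refine Or.inr (Finset.mem_smul_finset.2 ⟨_, h, ?_⟩)
    rw [smul_conj_smul_comm, smul_inv_smul]

/-- An antipodal-free weight stays antipodal-free under `τ ∈ Aut(ℂ)`. [folklore] -/
theorem forall_conj_smul_not_mem_smul_finset {S : Finset ((i : Fin n) × (K i →+* ℂ))}
    (hsec : ∀ x ∈ S, (starRingAut : ℂ ≃+* ℂ) • x ∉ S) (τ : ℂ ≃+* ℂ) :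
    ∀ x ∈ τ • S, (starRingAut : ℂ ≃+* ℂ) • x ∉ τ • S := by
  intro x hx hx'
  obtain ⟨y, hy, rfl⟩ := Finset.mem_smul_finset.1 hx
  rw [← smul_conj_smul_comm, Finset.smul_mem_smul_finset_iff] at hx'
  exact hsec y hy hx'

/-- **THE DICHOTOMY for balanced full sections** (pointwise in `τ`).  Let `S ⊆ ⊔_i Hom(K_i, ℂ)` be a balanced FULL
SECTION: `S` contains no conjugate pair (`hsec`) and meets every conjugate pair (`hfull`).  Then for every
`τ ∈ Aut(ℂ)`: `τ • S = S`, or `τ • S = ρ • S`, or `S` splits as a disjoint union `A ⊔ D` of two NONEMPTY balanced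
weights.  Proof: `τ • S` is again a balanced full section, so `τ • S = (S ∩ τ•S) ⊔ ρ • (S ∖ τ•S)`, and the splitting
lemma applied to `S = (S ∩ τ•S) ⊔ (S ∖ τ•S)` and `τ • S` makes both parts balanced. [folklore] -/
theorem section_dichotomy (Φ : ∀ i, CMType (K i)) {S : Finset ((i : Fin n) × (K i →+* ℂ))}
    (hS : IsGaloisBalancedAlg Φ S) (hsec : ∀ x ∈ S, (starRingAut : ℂ ≃+* ℂ) • x ∉ S)
    (hfull : ∀ x : (i : Fin n) × (K i →+* ℂ), x ∈ S ∨ (starRingAut : ℂ ≃+* ℂ) • x ∈ S) (τ : ℂ ≃+* ℂ) :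
    τ • S = S ∨ τ • S = (starRingAut : ℂ ≃+* ℂ) • S ∨
    ∃ A D : Finset ((i : Fin n) × (K i →+* ℂ)), A.Nonempty ∧ D.Nonempty ∧ Disjoint A D ∧ S = A ∪ D ∧
      IsGaloisBalancedAlg Φ A ∧ IsGaloisBalancedAlg Φ D := by
  have hS'bal : IsGaloisBalancedAlg Φ (τ • S) := isGaloisBalancedAlg_smul hS τ
  have hS'full := forall_mem_or_conj_smul_mem_smul_finset hfull τ
  have hS'sec := forall_conj_smul_not_mem_smul_finset hsec τ
  set A := S ∩ τ • S with hA
  set D := S \ τ • S with hD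
  have hSAD : S = A ∪ D := by rw [Finset.union_comm]; exact (Finset.sdiff_union_inter S (τ • S)).symm
  have hAD : Disjoint A D :=
    Finset.disjoint_left.2 fun x hx hx' => (Finset.mem_sdiff.1 hx').2 (Finset.mem_inter.1 hx).2
  -- `τ • S = A ⊔ ρ • D`
  have hS'eq : τ • S = A ∪ (starRingAut : ℂ ≃+* ℂ) • D := by
    ext x
    simp only [Finset.mem_union, hA, Finset.mem_inter, hD, Finset.mem_smul_finset (s := S \ τ • S),
      Finset.mem_sdiff]
    constructor
    · intro hx
      by_cases hxS : x ∈ S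
      · exact Or.inl ⟨hxS, hx⟩
      · right
        refine ⟨(starRingAut : ℂ ≃+* ℂ) • x, ⟨(hfull x).resolve_left hxS, fun h => hS'sec x hx h⟩, ?_⟩
        exact conj_smul_conj_smul x
    · rintro (⟨-, hx⟩ | ⟨y, ⟨-, hyS'⟩, rfl⟩)
      · exact hx
      · exact (hS'full y).resolve_left hyS'
  have hAD' : Disjoint A ((starRingAut : ℂ ≃+* ℂ) • D) := by
    rw [Finset.disjoint_left]
    rintro x hxA hx
    obtain ⟨y, hy, rfl⟩ := Finset.mem_smul_finset.1 hx
    exact hsec y (Finset.mem_sdiff.1 hy).1 (Finset.mem_inter.1 hxA).1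
  have hsplit := isGaloisBalancedAlg_split Φ hAD hAD' (hSAD ▸ hS) (hS'eq ▸ hS'bal)
  by_cases hDe : D = ∅
  · -- `S ⊆ τ • S`, same cardinality
    left
    have hsub : S ⊆ τ • S := fun x hx => by
      have hx' : x ∈ A ∪ D := hSAD ▸ hx
      rw [hDe, Finset.union_empty] at hx'
      exact (Finset.mem_inter.1 hx').2
    exact (Finset.eq_of_subset_of_card_le hsub (Finset.card_smul_finset τ S).le).symm
  by_cases hAe : A = ∅
  · right; left
    rw [hS'eq, hAe, Finset.empty_union, hSAD, hAe, Finset.empty_union]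
  · right; right
    exact ⟨A, D, Finset.nonempty_iff_ne_empty.2 hAe, Finset.nonempty_iff_ne_empty.2 hDe, hAD, hSAD, hsplit.1,
      hsplit.2⟩

/-- **THE DICHOTOMY, global form**: a balanced full section either is a «Weil section» — `τ • S ∈ {S, ρ • S}` for
EVERY `τ ∈ Aut(ℂ)` — or splits into two nonempty balanced weights. [folklore] -/
theorem weilSection_or_split (Φ : ∀ i, CMType (K i)) {S : Finset ((i : Fin n) × (K i →+* ℂ))}
    (hS : IsGaloisBalancedAlg Φ S) (hsec : ∀ x ∈ S, (starRingAut : ℂ ≃+* ℂ) • x ∉ S)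
    (hfull : ∀ x : (i : Fin n) × (K i →+* ℂ), x ∈ S ∨ (starRingAut : ℂ ≃+* ℂ) • x ∈ S) :
    (∀ τ : ℂ ≃+* ℂ, τ • S = S ∨ τ • S = (starRingAut : ℂ ≃+* ℂ) • S) ∨
    ∃ A D : Finset ((i : Fin n) × (K i →+* ℂ)), A.Nonempty ∧ D.Nonempty ∧ Disjoint A D ∧ S = A ∪ D ∧
      IsGaloisBalancedAlg Φ A ∧ IsGaloisBalancedAlg Φ D := by
  by_cases h : ∃ A D : Finset ((i : Fin n) × (K i →+* ℂ)), A.Nonempty ∧ D.Nonempty ∧ Disjoint A D ∧ S = A ∪ D ∧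
      IsGaloisBalancedAlg Φ A ∧ IsGaloisBalancedAlg Φ D
  · exact Or.inr h
  · refine Or.inl fun τ => ?_
    rcases section_dichotomy Φ hS hsec hfull τ with h1 | h2 | h3
    · exact Or.inl h1
    · exact Or.inr h2
    · exact absurd h3 h

end Dichotomy

/-! ### §4 Four-element weights on eight embeddings: divisor pairs or a Weil section -/

section Fourfold

variable {n : ℕ} {K : Fin n → Type} [∀ i, Field (K i)] [∀ i, NumberField (K i)] [∀ i, IsCMField (K i)]

omit [∀ i, NumberField (K i)] [∀ i, IsCMField (K i)] in
/-- A disjoint union of two balanced pairs is a Pohlmann divisor set of degree `2` (index of a product of two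
divisor classes). [cite: Gordon1999HodgeAVSurvey, 9.2.2] -/
theorem union_mem_pohlmannDivisorSetsAlg_two {Φ : ∀ i, CMType (K i)} {A D : Finset ((i : Fin n) × (K i →+* ℂ))}
    (hA : A ∈ pohlmannSetsAlg Φ 1) (hD : D ∈ pohlmannSetsAlg Φ 1) (hAD : Disjoint A D) :
    A ∪ D ∈ pohlmannDivisorSetsAlg Φ 2 := by
  rw [pohlmannDivisorSetsAlg_def, mem_disjointUnionsOf_succ]
  refine ⟨A, ?_, D, hD, hAD, (Finset.disjUnion_eq_union A D hAD).symm⟩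
  rw [mem_disjointUnionsOf_succ]
  exact ⟨∅, mem_disjointUnionsOf_zero.2 rfl, A, hA, Finset.disjoint_empty_left A,
    (Finset.empty_disjUnion A _).symm⟩

omit [∀ i, NumberField (K i)] [∀ i, IsCMField (K i)] in
/-- **A balanced `4`-set that splits into two nonempty balanced parts is a disjoint union of two balanced PAIRS**
(balanced weights have even cardinality), hence indexes a divisor monomial. [cite: Gordon1999HodgeAVSurvey, 9.2.2] -/
theorem mem_pohlmannDivisorSetsAlg_two_of_split {Φ : ∀ i, CMType (K i)}
    {S A D : Finset ((i : Fin n) × (K i →+* ℂ))} (hS4 : S.card = 4) (hAne : A.Nonempty) (hDne : D.Nonempty)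
    (hAD : Disjoint A D) (hSAD : S = A ∪ D) (hA : IsGaloisBalancedAlg Φ A) (hD : IsGaloisBalancedAlg Φ D) :
    S ∈ pohlmannDivisorSetsAlg Φ 2 := by
  have hcard : A.card + D.card = 4 := by rw [← Finset.card_union_of_disjoint hAD, ← hSAD, hS4]
  obtain ⟨a, ha⟩ := even_card_of_isGaloisBalancedAlg hA
  obtain ⟨d, hd⟩ := even_card_of_isGaloisBalancedAlg hD
  have hApos : 0 < A.card := Finset.card_pos.2 hAne
  have hDpos : 0 < D.card := Finset.card_pos.2 hDne
  have hA2 : A.card = 2 := by omega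
  have hD2 : D.card = 2 := by omega
  rw [hSAD]
  exact union_mem_pohlmannDivisorSetsAlg_two ⟨hA2, hA⟩ ⟨hD2, hD⟩ hAD

/-- **A balanced `4`-set containing a conjugate pair is a disjoint union of two balanced pairs** (the conjugate
pair is balanced, and so is the rest). [cite: Gordon1999HodgeAVSurvey, 9.2.2] -/
theorem mem_pohlmannDivisorSetsAlg_two_of_conj_smul_mem {Φ : ∀ i, CMType (K i)}
    {S : Finset ((i : Fin n) × (K i →+* ℂ))} (hS : S ∈ pohlmannSetsAlg Φ 2) {x : (i : Fin n) × (K i →+* ℂ)}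
    (hx : x ∈ S) (hx' : (starRingAut : ℂ ≃+* ℂ) • x ∈ S) : S ∈ pohlmannDivisorSetsAlg Φ 2 := by
  set P : Finset ((i : Fin n) × (K i →+* ℂ)) := {x} ∪ (starRingAut : ℂ ≃+* ℂ) • ({x} : Finset _) with hP
  have hPbal : IsGaloisBalancedAlg Φ P := isGaloisBalancedAlg_pair_conj Φ x
  have hPS : P ⊆ S := by
    intro y hy
    rw [hP, Finset.smul_finset_singleton, Finset.mem_union, Finset.mem_singleton, Finset.mem_singleton] at hy
    rcases hy with rfl | rfl
    · exact hx
    · exact hx'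
  have hPcard : P.card = 2 := by
    rw [hP, Finset.card_union_of_disjoint (disjoint_singleton_conj_smul Φ x), Finset.card_singleton,
      Finset.card_smul_finset, Finset.card_singleton]
  have hSP : S = P ∪ (S \ P) := (Finset.union_sdiff_of_subset hPS).symm
  have hd : Disjoint P (S \ P) := Finset.disjoint_sdiff
  have hrest : IsGaloisBalancedAlg Φ (S \ P) := isGaloisBalancedAlg_of_union_left (hSP ▸ hS.2) hPbal hd
  have hPne : P.Nonempty := by rw [← Finset.card_pos, hPcard]; norm_num
  have hRne : (S \ P).Nonempty := by
    rw [← Finset.card_pos, Finset.card_sdiff_of_subset hPS, hS.1, hPcard]; norm_num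
  exact mem_pohlmannDivisorSetsAlg_two_of_split hS.1 hPne hRne hd hSP hPbal hrest

omit [∀ i, IsCMField (K i)] in
/-- `|⊔_i Hom(K_i, ℂ)| = Σ_i [K_i : ℚ]`. [folklore] -/
theorem card_sigma_ringHom_complex : Fintype.card ((i : Fin n) × (K i →+* ℂ)) = ∑ i, Module.finrank ℚ (K i) := by
  rw [Fintype.card_sigma]
  exact Finset.sum_congr rfl fun i _ => Embeddings.card (K i) ℂ

omit [∀ i, IsCMField (K i)] in
/-- An antipodal-free `4`-subset of `8` embeddings is a FULL section (it meets every conjugate pair): `S ⊔ ρ•S`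
has `8` elements. [folklore] -/
theorem forall_mem_or_conj_smul_mem_of_card (hK : ∑ i, Module.finrank ℚ (K i) = 8)
    {S : Finset ((i : Fin n) × (K i →+* ℂ))} (hS4 : S.card = 4)
    (hsec : ∀ x ∈ S, (starRingAut : ℂ ≃+* ℂ) • x ∉ S) (x : (i : Fin n) × (K i →+* ℂ)) :
    x ∈ S ∨ (starRingAut : ℂ ≃+* ℂ) • x ∈ S := by
  have hd : Disjoint S ((starRingAut : ℂ ≃+* ℂ) • S) := by
    rw [Finset.disjoint_left]
    intro y hy hy'
    obtain ⟨z, hz, rfl⟩ := Finset.mem_smul_finset.1 hy'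
    exact hsec z hz hy
  have hcard : (S ∪ (starRingAut : ℂ ≃+* ℂ) • S).card = Fintype.card ((i : Fin n) × (K i →+* ℂ)) := by
    rw [Finset.card_union_of_disjoint hd, Finset.card_smul_finset, hS4, card_sigma_ringHom_complex, hK]
  have huniv : S ∪ (starRingAut : ℂ ≃+* ℂ) • S = Finset.univ := Finset.eq_univ_of_card _ hcard
  have hx : (starRingAut : ℂ ≃+* ℂ) • x ∈ S ∪ (starRingAut : ℂ ≃+* ℂ) • S := huniv ▸ Finset.mem_univ _
  rcases Finset.mem_union.1 hx with h | h
  · exact Or.inr h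
  · rw [Finset.smul_mem_smul_finset_iff] at h
    exact Or.inl h

/-- **Divisor pairs or a Weil section (total dimension `4`).**  For a family of CM fields with `Σ_i [K_i:ℚ] = 8` and
CM types `Φ_i`, every balanced `4`-subset `S` of `⊔_i Hom(K_i, ℂ)` (an index of `B² ⊗ ℂ` of the product fourfold,
by Pohlmann's theorem) is EITHER a disjoint union of two balanced pairs (`pohlmannDivisorSetsAlg Φ 2`: the index of a
product of two divisor classes) OR a «Weil section»: `S` picks exactly one embedding out of each conjugate pair and
`τ • S ∈ {S, ρ • S}` for every `τ ∈ Aut(ℂ)` (the index of a generator `⋀⁴ V₊` of the Weil plane of an imaginary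
quadratic multiplication, see `CorCM/CMWeilSectionEndomorphism`).  This is the combinatorial content of
the CM slice of Moonen–Zarhin's Thm. 0.1 («`B²(X) = D²(X) + Σ W_k`» for abelian fourfolds), here with an elementary
proof valid for arbitrary CM-algebra data (no primitivity, no rank computation).
[cite: MoonenZarhin1999LowDim, Thm. 0.1] -/
theorem mem_pohlmannDivisorSetsAlg_two_or_weilSection (hK : ∑ i, Module.finrank ℚ (K i) = 8)
    (Φ : ∀ i, CMType (K i)) {S : Finset ((i : Fin n) × (K i →+* ℂ))} (hS : S ∈ pohlmannSetsAlg Φ 2) :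
    S ∈ pohlmannDivisorSetsAlg Φ 2 ∨
    ((∀ x ∈ S, (starRingAut : ℂ ≃+* ℂ) • x ∉ S) ∧
      (∀ x : (i : Fin n) × (K i →+* ℂ), x ∈ S ∨ (starRingAut : ℂ ≃+* ℂ) • x ∈ S) ∧
      ∀ τ : ℂ ≃+* ℂ, τ • S = S ∨ τ • S = (starRingAut : ℂ ≃+* ℂ) • S) := by
  by_cases hpair : ∃ x ∈ S, (starRingAut : ℂ ≃+* ℂ) • x ∈ S
  · obtain ⟨x, hx, hx'⟩ := hpair
    exact Or.inl (mem_pohlmannDivisorSetsAlg_two_of_conj_smul_mem hS hx hx')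
  · have hsec : ∀ x ∈ S, (starRingAut : ℂ ≃+* ℂ) • x ∉ S := fun x hx hx' => hpair ⟨x, hx, hx'⟩
    have hS4 : S.card = 4 := hS.1
    have hfull := forall_mem_or_conj_smul_mem_of_card hK hS4 hsec
    rcases weilSection_or_split Φ hS.2 hsec hfull with h | ⟨A, D, hAne, hDne, hAD, hSAD, hA, hD⟩
    · exact Or.inr ⟨hsec, hfull, h⟩
    · exact Or.inl (mem_pohlmannDivisorSetsAlg_two_of_split hS4 hAne hDne hAD hSAD hA hD)

end Fourfold

end Summit.HodgeConjecture.CorCM.CMWeights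

end
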